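import Mathlib
import Summits.NavierStokesRegularity.NavierStokesRegularity.Theorems.EulerZoomLiouvillePowerGaugeEulerLiouvilleSelfSimilarNoDrift
import Summits.NavierStokesRegularity.NavierStokesRegularity.Theorems.EulerZoomLiouvillePowerGaugeEulerLiouvilleSelfSimilarBoundedConfinement
import HarnessLib.Audit

/-!
# Rung C1 of the crux `EulerZoomLiouville.PowerGaugeEulerLiouville`, NO-DRIFT lane: the convergence theorem at a
# transversally non-degenerate limit node WITHOUT the pressure normalisation `P ≤ P₀`

Route №10 `EulerZoomLiouville` (NavierStokesRegularity), crux E = stmt-NavierStokesRegularity-19832, tenure rung C1,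
registered residue `stub_selfSimilarExtremalRest`.  Lineage ns-typeII-p2 (gen 8).  Sequel of
`…SelfSimilarBoundedConfinement`: the no-drift theorem `NoDrift.tendsto_flow_atBot_of_bordered_clusterPt` (gen 7, p567663)
used `P ≤ P₀` only through the three confinement lemmas `norm_flow_le_of_nonpos`, `mem_nodalSet_of_mapClusterPt_atBot`,
`integrableOn_norm_transport_sq_backward`; with their pressure-free twins the same passage-budget proof gives

* **`tendsto_flow_atBot_of_bordered_clusterPt'`** — `0 < γ < ½`, `V` smooth, `‖V‖ ≤ M`, `‖DV‖ ≤ K`, `(V, P)` a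
  self-similar Euler profile (CIV (3.3)), NO hypothesis on `P`: a backward trajectory with a limit node `z₀` at which
  `0` is a simple eigenvalue of `DW(z₀)` (bordered operator `DW(z₀) + ⟪e,·⟫e` invertible) converges to one stagnation
  point.

WHAT THIS IS NOT: not NS, not E, not rung C1 — a convergence theorem for backward trajectories of bounded classical
in-window profiles.  [folklore; cf. B. Aulbach, LNM 1058 (1984), Thm 2.3 (statement only; the proof is the lineage's
passage budget); ConstantinIgnatovaVicol2026Putative §3.4.3 (3.31)]
-/

noncomputable section

-- flat `Theorems/<Route><Decl>…` files of one crux share the namespace of the crux (tree convention)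
set_option linter.dupNamespace false

open MeasureTheory Set Filter Topology Metric Function InnerProductSpace
open scoped RealInnerProductSpace NNReal ContDiff

namespace Summit.NavierStokesRegularity.NavierStokesRegularity.Theorems.PowerGaugeEulerLiouville.NoDrift

open Literature.Analysis Literature.Analysis.FluidPDE
open Summit.NavierStokesRegularity.NavierStokesRegularity.Theorems.PowerGaugeEulerLiouville.Kelvin

variable {γ : ℝ} {V : EuclideanSpace ℝ (Fin 3) → EuclideanSpace ℝ (Fin 3)} {P : EuclideanSpace ℝ (Fin 3) → ℝ}

/-- **NO DRIFT — pressure-free form of `tendsto_flow_atBot_of_bordered_clusterPt`.**  `0 < γ < ½`, `V` smooth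
with `‖V‖ ≤ M`, `‖DV‖ ≤ K` (NO condition on `P`), `(V, P)` a self-similar Euler profile, `W = γy + V`.  If `z₀` is a
backward limit point of `x`, `DW(z₀) e = 0` for a unit `e`, and `DW(z₀) + ⟪e,·⟫e` is a linear homeomorphism, then
`Φ_s x` converges, as `s → −∞`, to a stagnation point.  Proof verbatim from the original with the confinement radius
`‖x‖ + M/γ` of `norm_flow_le_of_nonpos'`. [folklore; cf. Aulbach, LNM 1058 (1984), Thm 2.3] -/
theorem tendsto_flow_atBot_of_bordered_clusterPt' (hV : ContDiff ℝ ∞ V) {K : ℝ} (hK : ∀ y, ‖fderiv ℝ V y‖ ≤ K)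
    (hprof : IsSelfSimilarEulerProfile γ 0 V P) {M : ℝ} (hM : ∀ y, ‖V y‖ ≤ M)
    (hγ : 0 < γ) (hγ2 : γ < 1 / 2) (x : EuclideanSpace ℝ (Fin 3)) {z₀ : EuclideanSpace ℝ (Fin 3)}
    (hz₀ : MapClusterPt z₀ atBot fun s => ODE.evolutionMap (fun _ : ℝ => selfSimilarTransport γ 0 V) 0 s x)
    {e : EuclideanSpace ℝ (Fin 3)} (he : ‖e‖ = 1) (hLe : fderiv ℝ (selfSimilarTransport γ 0 V) z₀ e = 0)
    (T : EuclideanSpace ℝ (Fin 3) ≃L[ℝ] EuclideanSpace ℝ (Fin 3))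
    (hT : (T : EuclideanSpace ℝ (Fin 3) →L[ℝ] EuclideanSpace ℝ (Fin 3)) =
      fderiv ℝ (selfSimilarTransport γ 0 V) z₀ + (innerSL ℝ e).smulRight e) :
    ∃ z ∈ selfSimilarNodalSet γ 0 V,
      Tendsto (fun s => ODE.evolutionMap (fun _ : ℝ => selfSimilarTransport γ 0 V) 0 s x) atBot (𝓝 z) := by
  set W := selfSimilarTransport γ 0 V with hWdef
  set Φ := ODE.evolutionMap (fun _ : ℝ => W) 0 with hΦdef
  have hW2 : ContDiff ℝ 2 W := contDiff_selfSimilarTransport (γ := γ) (hV.of_le (by norm_cast))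
  have hWc : Continuous W := hW2.continuous
  -- compact tail and continuity of the trajectory
  set B : ℝ := ‖x‖ + M / γ with hB
  have hKc : IsCompact (closedBall (0 : EuclideanSpace ℝ (Fin 3)) B) := isCompact_closedBall 0 B
  have htail : ∀ᶠ s in atBot, Φ s x ∈ closedBall (0 : EuclideanSpace ℝ (Fin 3)) B := by
    filter_upwards [eventually_le_atBot (0 : ℝ)] with s hs
    rw [mem_closedBall, dist_zero_right, hB]
    exact norm_flow_le_of_nonpos' hV hK hM hγ x hs
  have hcont : Continuous fun s => Φ s x := continuous_flow_apply (γ := γ) hV hK x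
  -- the limit set: nodes, preconnected
  set Z : Set (EuclideanSpace ℝ (Fin 3)) := {z | MapClusterPt z atBot fun s => Φ s x} with hZdef
  have hZN : ∀ z ∈ Z, W z = 0 := fun z hz => mem_nodalSet_of_mapClusterPt_atBot' hV hK hprof hM hγ hγ2 hz
  have hZpre : IsPreconnected Z := isPreconnected_setOf_mapClusterPt hcont hKc htail
  by_contra hnot
  push Not at hnot
  -- a second limit point
  obtain ⟨z₁, hz₁, hne⟩ : ∃ z₁, z₁ ∈ Z ∧ z₁ ≠ z₀ := by
    by_contra h
    push Not at h
    exact hnot z₀ (hZN z₀ hz₀) (hKc.tendsto_nhds_of_unique_mapClusterPt htail fun z _ hz => h z hz)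
  -- 1. the `C²` arc through `z₀` carrying the nearby nodes
  obtain ⟨δ, hδ, ρ, hρ, c, hc2, hc0, hcd0, -, hτc, hzero⟩ := exists_zeroCurve_of_corankOne hW2 (hZN z₀ hz₀) he hLe T hT
  have h0I : (0 : ℝ) ∈ Ioo (-δ) δ := ⟨by linarith, hδ⟩
  have hcAt : ContinuousAt c 0 := hc2.continuousOn.continuousAt (isOpen_Ioo.mem_nhds h0I)
  obtain ⟨ε₂, hε₂, hε₂c⟩ : ∃ ε₂ : ℝ, 0 < ε₂ ∧ ∀ t : ℝ, |t| < ε₂ → dist (c t) z₀ < ρ / 2 := by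
    obtain ⟨ε₂, hε₂, h⟩ := Metric.continuousAt_iff.1 hcAt (ρ / 2) (half_pos hρ)
    refine ⟨ε₂, hε₂, fun t ht => ?_⟩
    have := h (by rw [dist_zero_right, Real.norm_eq_abs]; exact ht)
    rwa [hc0] at this
  -- bordered operators stay invertible along the arc near `0`
  have hT' : (T : EuclideanSpace ℝ (Fin 3) →L[ℝ] EuclideanSpace ℝ (Fin 3)) =
      (innerSL ℝ e).smulRight (deriv c 0 - fderiv ℝ W (c 0) e) + fderiv ℝ W (c 0) := by
    rw [hcd0.deriv, hc0, hLe, sub_zero, hT, add_comm]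
  obtain ⟨ε₁, hε₁, hbord⟩ := Metric.eventually_nhds_iff.1
    (eventually_exists_borderedEquiv hW2 isOpen_Ioo h0I (hc2.of_le (by norm_num)) e T hT')
  -- 2. a node sub-arc of the limit set and its midpoint `t₀`
  set ε : ℝ := min δ (min ε₁ ε₂) with hεdef
  have hε : 0 < ε := by rw [hεdef]; positivity
  obtain ⟨α, β, hαβ, hsubI, harcZ⟩ :=
    exists_subarc_of_isPreconnected_subset_zeroSet hρ hc0 hcAt hzero hZpre hZN hz₀ hz₁ hne hε
  set t₀ : ℝ := (α + β) / 2 with ht₀def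
  have ht₀ : t₀ ∈ Ioo α β := ⟨by rw [ht₀def]; linarith, by rw [ht₀def]; linarith⟩
  have hIε : Ioo α β ⊆ Ioo (-ε) ε := fun t ht => hsubI (Ioo_subset_Icc_self ht)
  have hIδ : Ioo α β ⊆ Ioo (-δ) δ := fun t ht => by
    have h := hIε ht
    exact ⟨lt_of_le_of_lt (neg_le_neg (min_le_left _ _)) h.1, lt_of_lt_of_le h.2 (min_le_left _ _)⟩
  have ht₀ε : |t₀| < ε := abs_lt.2 (hIε ht₀)
  have harc : ∀ t ∈ Ioo α β, W (c t) = 0 := fun t ht => hZN _ (harcZ t (Ioo_subset_Icc_self ht))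
  have hct₀Z : c t₀ ∈ Z := harcZ t₀ (Ioo_subset_Icc_self ht₀)
  have hc1 : ContDiffOn ℝ 1 c (Ioo α β) := (hc2.mono hIδ).of_le (by norm_num)
  obtain ⟨T₀, hT₀⟩ := hbord (y := t₀)
    (by rw [dist_zero_right, Real.norm_eq_abs]
        exact lt_of_lt_of_le ht₀ε ((min_le_right _ _).trans (min_le_left _ _)))
  -- the parameter map and the zero structure near `c t₀`
  set τf : EuclideanSpace ℝ (Fin 3) → ℝ := fun y => ⟪e, W y⟫ + ⟪e, y - z₀⟫ with hτfdef
  have hτcont : Continuous τf :=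
    (continuous_const.inner hWc).add (continuous_const.inner (continuous_id.sub continuous_const))
  have hτc' : ∀ t ∈ Ioo α β, τf (c t) = t := fun t ht => hτc t (hIδ ht)
  have hdist₀ : dist (c t₀) z₀ < ρ / 2 :=
    hε₂c t₀ (lt_of_lt_of_le ht₀ε ((min_le_right _ _).trans (min_le_right _ _)))
  obtain ⟨ρ₃, hρ₃, hρ₃P⟩ : ∃ ρ₃ : ℝ, 0 < ρ₃ ∧ ∀ y, dist y (c t₀) < ρ₃ → τf y ∈ Ioo α β := by
    have h : τf ⁻¹' Ioo α β ∈ 𝓝 (c t₀) := by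
      refine hτcont.continuousAt.preimage_mem_nhds (isOpen_Ioo.mem_nhds ?_)
      rw [hτc' t₀ ht₀]; exact ht₀
    obtain ⟨ρ₃, hρ₃, hsub⟩ := Metric.mem_nhds_iff.1 h
    exact ⟨ρ₃, hρ₃, fun y hy => hsub hy⟩
  set ρ' : ℝ := min (ρ / 2) ρ₃ with hρ'def
  have hρ' : 0 < ρ' := by rw [hρ'def]; positivity
  have hzero' : ∀ y ∈ ball (c t₀) ρ', W y = 0 → ∃ t ∈ Ioo α β, y = c t := by
    intro y hy hWy
    rw [mem_ball] at hy
    have hyρ : y ∈ ball z₀ ρ := by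
      rw [mem_ball]
      calc dist y z₀ ≤ dist y (c t₀) + dist (c t₀) z₀ := dist_triangle _ _ _
        _ < ρ / 2 + ρ / 2 := add_lt_add (lt_of_lt_of_le hy (min_le_left _ _)) hdist₀
        _ = ρ := by ring
    obtain ⟨-, hcy⟩ := hzero y hyρ hWy
    have hτy : τf y = ⟪e, y - z₀⟫ := by simp only [hτfdef, hWy, inner_zero_right, zero_add]
    refine ⟨⟪e, y - z₀⟫, ?_, hcy.symm⟩
    rw [← hτy]; exact hρ₃P y (lt_of_lt_of_le hy (min_le_right _ _))
  -- 3. the drift chart at `c t₀`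
  obtain ⟨D, f, g, η, r, Kc, d₀, hDo, hcD, hfc, hgc, hf0, hg0, hη, hr, hKc0, hd₀, hcpt, hdrift, hlat, hzarc⟩ :=
    exists_driftChart hW2 ht₀ hc1 harc he T₀ hT₀ hρ' hzero' hτcont hτc'
  set Tube : Set (EuclideanSpace ℝ (Fin 3)) := {y | y ∈ D ∧ |f y - t₀| < η ∧ g y < r} with hTubedef
  set CT : Set (EuclideanSpace ℝ (Fin 3)) := {y | y ∈ D ∧ |f y - t₀| ≤ η ∧ g y ≤ r} with hCTdef
  have hopen_of : ∀ a κ : ℝ, IsOpen {y | y ∈ D ∧ |f y - a| < κ ∧ g y < r} := by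
    intro a κ
    have h1 : IsOpen (D ∩ f ⁻¹' {b | |b - a| < κ}) :=
      hfc.isOpen_inter_preimage hDo (isOpen_lt (continuous_id.sub continuous_const).abs continuous_const)
    have h2 : IsOpen ((D ∩ f ⁻¹' {b | |b - a| < κ}) ∩ g ⁻¹' Iio r) :=
      (hgc.mono inter_subset_left).isOpen_inter_preimage h1 isOpen_Iio
    convert h2 using 1
    ext y; simp only [mem_setOf_eq, mem_inter_iff, mem_preimage, mem_Iio]; tauto
  have hTubeo : IsOpen Tube := hopen_of t₀ η
  have hTubeCT : Tube ⊆ CT := fun y hy => ⟨hy.1, hy.2.1.le, hy.2.2.le⟩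
  have hclTube : closure Tube ⊆ CT := closure_minimal hTubeCT hcpt.isClosed
  -- 4. the backward trajectory `Yb t = Φ (−t) x`
  set Yb : ℝ → EuclideanSpace ℝ (Fin 3) := fun t => Φ (-t) x with hYbdef
  have hYd : ∀ t, HasDerivAt Yb ((-1 : ℝ) • W (Yb t)) t := fun t => hasDerivAt_flow_neg (γ := γ) hV hK x t
  have hYc : Continuous Yb := hcont.comp continuous_neg
  have hWYc : Continuous fun t => ‖W (Yb t)‖ ^ 2 := ((hWc.comp hYc).norm).pow 2
  have hclus : ∀ z, MapClusterPt z atTop Yb ↔ z ∈ Z := by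
    intro z
    have e1 : Yb = (fun s => Φ s x) ∘ Neg.neg := rfl
    rw [e1, mapClusterPt_comp, Filter.map_neg_atTop]
    exact Iff.rfl
  have hint : IntegrableOn (fun t => ‖W (Yb t)‖ ^ 2) (Ioi 0) :=
    integrableOn_norm_transport_sq_backward' hV hK hprof hM hγ hγ2 x
  set Itot : ℝ := ∫ t in Ioi 0, ‖W (Yb t)‖ ^ 2 with hItot
  -- the passage inequality
  have hineq : ∀ t₁ u₁ : ℝ, t₁ < u₁ → (∀ s ∈ Ico t₁ u₁, Yb s ∈ Tube) → Yb u₁ ∈ D →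
      |f (Yb u₁) - f (Yb t₁)| ≤ Kc * ∫ s in t₁..u₁, ‖W (Yb s)‖ ^ 2 := by
    intro t₁ u₁ htu hin hD
    have hmaps : MapsTo Yb (Icc t₁ u₁) D := by
      intro s hs
      rcases eq_or_lt_of_le hs.2 with h | h
      · rw [h]; exact hD
      · exact (hin s ⟨hs.1, h⟩).1
    have hF : ContinuousOn (fun s => f (Yb s) - f (Yb t₁)) (Icc t₁ u₁) :=
      ((hfc.comp hYc.continuousOn hmaps).sub continuousOn_const)
    have hF' : ∀ s ∈ Ico t₁ u₁, HasDerivWithinAt (fun s => f (Yb s) - f (Yb t₁))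
        (fderiv ℝ f (Yb s) ((-1 : ℝ) • W (Yb s))) (Ici s) s := by
      intro s hs
      have h1 := ((hdrift (Yb s) (hin s hs).1 (hin s hs).2.1 (hin s hs).2.2).1.hasFDerivAt).comp_hasDerivAt s
        (hYd s)
      exact (h1.sub_const (f (Yb t₁))).hasDerivWithinAt
    have hB : ∀ s, HasDerivAt (fun s => Kc * ∫ τ in t₁..s, ‖W (Yb τ)‖ ^ 2) (Kc * ‖W (Yb s)‖ ^ 2) s :=
      fun s => ((hWYc.integral_hasStrictDerivAt t₁ s).hasDerivAt).const_mul Kc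
    have hbound : ∀ s ∈ Ico t₁ u₁, ‖fderiv ℝ f (Yb s) ((-1 : ℝ) • W (Yb s))‖ ≤ Kc * ‖W (Yb s)‖ ^ 2 := by
      intro s hs
      rw [map_smul, neg_one_smul, norm_neg, Real.norm_eq_abs]
      exact (hdrift (Yb s) (hin s hs).1 (hin s hs).2.1 (hin s hs).2.2).2
    have h := image_norm_le_of_norm_deriv_right_le_deriv_boundary hF hF'
      (B := fun s => Kc * ∫ τ in t₁..s, ‖W (Yb τ)‖ ^ 2) (by simp) hB hbound (right_mem_Icc.2 htu.le)
    rw [Real.norm_eq_abs] at h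
    exact h
  -- the budget: passages beyond every time are impossible
  have hbudget : ∀ κ : ℝ, 0 < κ → (∀ Tm : ℝ, 0 ≤ Tm → ∃ t u : ℝ, Tm ≤ t ∧ t < u ∧ (∀ s ∈ Ico t u, Yb s ∈ Tube) ∧
      Yb u ∈ D ∧ κ ≤ |f (Yb u) - f (Yb t)|) → False := by
    intro κ hκ hpass
    have hii : ∀ a b : ℝ, IntervalIntegrable (fun t => ‖W (Yb t)‖ ^ 2) volume a b :=
      fun a b => hWYc.intervalIntegrable a b
    have step : ∀ n : ℕ, ∃ u : ℝ, 0 ≤ u ∧ (n : ℝ) * (κ / Kc) ≤ ∫ s in (0 : ℝ)..u, ‖W (Yb s)‖ ^ 2 := by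
      intro n
      induction n with
      | zero => exact ⟨0, le_rfl, by simp⟩
      | succ n ih =>
        obtain ⟨u, hu0, hn⟩ := ih
        obtain ⟨t, u', htu, htu', hin, hD, hκle⟩ := hpass u hu0
        have h1 := hineq t u' htu' hin hD
        have h2 : κ / Kc ≤ ∫ s in t..u', ‖W (Yb s)‖ ^ 2 := by
          rw [div_le_iff₀ hKc0]
          calc κ ≤ |f (Yb u') - f (Yb t)| := hκle
            _ ≤ Kc * ∫ s in t..u', ‖W (Yb s)‖ ^ 2 := h1
            _ = (∫ s in t..u', ‖W (Yb s)‖ ^ 2) * Kc := mul_comm _ _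
        have h3 : ∫ s in t..u', ‖W (Yb s)‖ ^ 2 ≤ ∫ s in u..u', ‖W (Yb s)‖ ^ 2 :=
          intervalIntegral.integral_mono_interval htu htu'.le le_rfl
            (Eventually.of_forall fun s => sq_nonneg _) (hii u u')
        have h4 : ∫ s in (0 : ℝ)..u', ‖W (Yb s)‖ ^ 2 =
            (∫ s in (0 : ℝ)..u, ‖W (Yb s)‖ ^ 2) + ∫ s in u..u', ‖W (Yb s)‖ ^ 2 :=
          (intervalIntegral.integral_add_adjacent_intervals (hii 0 u) (hii u u')).symm
        refine ⟨u', by linarith, ?_⟩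
        rw [h4]; push_cast; linarith
    have hle : ∀ u : ℝ, 0 ≤ u → ∫ s in (0 : ℝ)..u, ‖W (Yb s)‖ ^ 2 ≤ Itot := by
      intro u hu
      rw [intervalIntegral.integral_of_le hu, hItot]
      exact setIntegral_mono_set hint (Eventually.of_forall fun s => sq_nonneg _) Ioc_subset_Ioi_self.eventuallyLE
    obtain ⟨n, hn⟩ := exists_nat_gt (Itot / (κ / Kc))
    obtain ⟨u, hu0, hu⟩ := step n
    have h1 : (n : ℝ) * (κ / Kc) ≤ Itot := hu.trans (hle u hu0)
    have h2 : Itot < (n : ℝ) * (κ / Kc) := by rwa [div_lt_iff₀ (div_pos hκ hKc0)] at hn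
    linarith
  -- 5. late times: the trajectory is within `d₀` of the stagnation set
  obtain ⟨T₁, hT₁0, hT₁⟩ : ∃ T₁ : ℝ, 0 ≤ T₁ ∧ ∀ t, T₁ ≤ t → ∃ z, W z = 0 ∧ dist (Yb t) z < d₀ := by
    have hOo : IsOpen {y : EuclideanSpace ℝ (Fin 3) | ∃ z, W z = 0 ∧ dist y z < d₀} := by
      have : {y : EuclideanSpace ℝ (Fin 3) | ∃ z, W z = 0 ∧ dist y z < d₀} = ⋃ z ∈ {z | W z = 0}, ball z d₀ := by
        ext y; simp [mem_ball]
      rw [this]; exact isOpen_biUnion fun z _ => isOpen_ball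
    have hev := eventually_mem_of_mapClusterPt_subset hKc htail hOo
      fun z hz => ⟨z, hZN z hz, by rw [dist_self]; exact hd₀⟩
    obtain ⟨S, hS⟩ := eventually_atBot.1 hev
    refine ⟨max (-S) 0, le_max_right _ _, fun t ht => ?_⟩
    exact hS (-t) (by linarith [le_max_left (-S) 0])
  -- 6. case analysis
  by_cases hstay : ∃ T₂ : ℝ, ∀ t, T₂ ≤ t → Yb t ∈ Tube
  · -- (i) the trajectory eventually stays in the tube: all limit points have the same `f`-value …
    obtain ⟨T₂, hT₂⟩ := hstay
    have hevTube : ∀ᶠ t in atTop, Yb t ∈ CT := eventually_atTop.2 ⟨T₂, fun t ht => hTubeCT (hT₂ t ht)⟩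
    have hZCT : ∀ z ∈ Z, z ∈ CT := fun z hz =>
      mem_of_mapClusterPt_of_eventually hcpt.isClosed hevTube ((hclus z).2 hz)
    have hsame : ∀ z ∈ Z, ∀ z' ∈ Z, f z = f z' := by
      intro z hz z' hz'
      by_contra hfne
      set κ : ℝ := |f z' - f z| / 3 with hκdef
      have hκ : 0 < κ := by rw [hκdef]; exact div_pos (abs_pos.2 (sub_ne_zero.2 (Ne.symm hfne))) three_pos
      -- near `z` (resp. `z'`) the value of `f` is within `κ` of `f z` (resp. `f z'`), frequently
      have hnear : ∀ w ∈ Z, ∃ᶠ t in atTop, Yb t ∈ D ∧ |f (Yb t) - f w| < κ := by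
        intro w hw
        have hwD : w ∈ D := (hZCT w hw).1
        have hO : IsOpen (D ∩ f ⁻¹' {b | |b - f w| < κ}) :=
          hfc.isOpen_inter_preimage hDo (isOpen_lt (continuous_id.sub continuous_const).abs continuous_const)
        have hwO : w ∈ D ∩ f ⁻¹' {b | |b - f w| < κ} := ⟨hwD, by simp [hκ]⟩
        exact (((hclus w).2 hw).frequently (hO.mem_nhds hwO)).mono fun t ht => ⟨ht.1, ht.2⟩
      refine hbudget κ hκ fun Tm hTm => ?_
      obtain ⟨t, ht, htD, htκ⟩ := frequently_atTop.1 (hnear z hz) (max Tm T₂)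
      obtain ⟨u, hu, huD, huκ⟩ := frequently_atTop.1 (hnear z' hz') (t + 1)
      refine ⟨t, u, (le_max_left _ _).trans ht, by linarith, fun s hs => hT₂ s ?_, huD, ?_⟩
      · exact ((le_max_right _ _).trans ht).trans hs.1
      · -- `|f(Y u) − f(Y t)| ≥ |f z' − f z| − 2κ = κ`
        have h3 : |f z' - f z| = 3 * κ := by rw [hκdef]; ring
        have := abs_sub_abs_le_abs_sub (f z' - f z) ((f z' - f (Yb u)) + (f (Yb t) - f z))
        have h4 : |(f z' - f (Yb u)) + (f (Yb t) - f z)| < 2 * κ := by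
          calc |(f z' - f (Yb u)) + (f (Yb t) - f z)| ≤ |f z' - f (Yb u)| + |f (Yb t) - f z| := abs_add_le _ _
            _ < κ + κ := add_lt_add (by rw [abs_sub_comm]; exact huκ) htκ
            _ = 2 * κ := by ring
        have h5 : f z' - f z - ((f z' - f (Yb u)) + (f (Yb t) - f z)) = f (Yb u) - f (Yb t) := by ring
        rw [h5] at this
        linarith
    -- … hence they coincide, and the trajectory converges
    have huniq : ∀ z ∈ Z, z = z₀ := by
      intro z hz
      obtain ⟨-, hcz⟩ := hzarc z (hZCT z hz).1 (hZCT z hz).2.1 (hZCT z hz).2.2 (hZN z hz)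
      obtain ⟨-, hcz₀⟩ := hzarc z₀ (hZCT z₀ hz₀).1 (hZCT z₀ hz₀).2.1 (hZCT z₀ hz₀).2.2 (hZN z₀ hz₀)
      rw [← hcz, ← hcz₀, hsame z hz z₀ hz₀]
    exact hnot z₀ (hZN z₀ hz₀) (hKc.tendsto_nhds_of_unique_mapClusterPt htail fun z _ hz => huniq z hz)
  · -- (ii) the trajectory leaves the tube again and again: passages from the core to a cap
    push Not at hstay
    have hcore_open : IsOpen {y | y ∈ D ∧ |f y - t₀| < η / 4 ∧ g y < r} := hopen_of t₀ (η / 4)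
    have hcore_mem : c t₀ ∈ {y | y ∈ D ∧ |f y - t₀| < η / 4 ∧ g y < r} := by
      refine ⟨hcD, ?_, ?_⟩
      · rw [hf0, sub_self, abs_zero]; positivity
      · rw [hg0]; exact hr
    refine hbudget (η / 2) (by positivity) fun Tm hTm => ?_
    have hfreq : ∃ᶠ t in atTop, Yb t ∈ {y | y ∈ D ∧ |f y - t₀| < η / 4 ∧ g y < r} :=
      ((hclus (c t₀)).2 hct₀Z).frequently (hcore_open.mem_nhds hcore_mem)
    obtain ⟨t, ht, htcore⟩ := frequently_atTop.1 hfreq (max Tm T₁)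
    have htTube : Yb t ∈ Tube := ⟨htcore.1, by linarith only [htcore.2.1, hη], htcore.2.2⟩
    obtain ⟨t', ht', hout'⟩ := hstay (t + 1)
    obtain ⟨u, htu, -, hin, hout, hcl⟩ := exists_first_exit hYc hTubeo (by linarith only [ht']) htTube hout'
    have huCT : Yb u ∈ CT := hclTube hcl
    refine ⟨t, u, (le_max_left _ _).trans ht, htu, hin, huCT.1, ?_⟩
    -- exit through a cap: the lateral boundary is excluded at late times
    have hcap : |f (Yb u) - t₀| = η := by
      by_contra hne'
      have hlt : |f (Yb u) - t₀| < η := lt_of_le_of_ne huCT.2.1 hne'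
      have hg : g (Yb u) = r := by
        by_contra hgne
        exact hout ⟨huCT.1, hlt, lt_of_le_of_ne huCT.2.2 hgne⟩
      obtain ⟨z, hz, hdz⟩ := hT₁ u (((le_max_right _ _).trans ht).trans htu.le)
      exact absurd (hlat (Yb u) huCT.1 huCT.2.1 hg z hz) (not_le.2 hdz)
    have h1 : |f (Yb t) - t₀| < η / 4 := htcore.2.1
    have h2 := abs_sub_abs_le_abs_sub (f (Yb u) - t₀) (f (Yb t) - t₀)
    rw [hcap, show f (Yb u) - t₀ - (f (Yb t) - t₀) = f (Yb u) - f (Yb t) by ring] at h2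
    linarith only [h1, h2, hη]

end Summit.NavierStokesRegularity.NavierStokesRegularity.Theorems.PowerGaugeEulerLiouville.NoDrift

end
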